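import Literature.Probability.RandomPlanarGeometry.SAWWordBridges
import Literature.Probability.RandomPlanarGeometry.SAWUnfoldingStep
import HarnessLib

/-!
# Line `kesten-product-renewal-dictionary` for the crux `SAWTotalPositivity.CriticalBubbleBound`
(stmt-CriticalPhenomena-7117): the one-step Hammersley–Welsh cut of a half-space word (stub H1)

In the step-word model of self-avoiding walks on `ℤ²` (`SAWWords.lean`, `SAWWordBridges.lean`:
`Step = Fin 4`, `0 ↦ +e₀`, `1 ↦ +e₁`, `2 ↦ -e₀`, `3 ↦ -e₁`; `traj w i` is the position after `i`
steps, `xAt w i = traj w i 0` the first coordinate, `xEnd w` the span) we prove the single step of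
the Hammersley–Welsh decomposition of a half-space walk into bridges (Madras–Slade 1993, §3.1,
proof of Theorem 3.1.1, eqs. (3.1.2)–(3.1.4), and proof of Proposition 3.1.5): a non-empty
self-avoiding half-space word `w` (`0 < x(i)` for `1 ≤ i ≤ |w|`) is cut at `c = n₁(w)`, the LAST
time its first coordinate attains its maximum `A = A₁(w)` (`Zd.lastArgmax`, `Zd.maxLevel` of
`SAWUnfoldingStep.lean`). Then

* the head `w.take c` is a self-avoiding bridge word of span exactly `A`
  (`take_lastArgmax_isBridgeW`);
* the tail `w.drop c` with every letter reflected in the vertical axis (`0 ↔ 2`, i.e. any letter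
  map negating `dx` and fixing `dy`) is again a self-avoiding half-space word, of maximum `≤ A - 1`
  (`drop_lastArgmax_spec`, `isSAW_map_of_dx`);
* `|head| + |tail| = |w|`, and `w ↦ (head, reflected tail)` is injective on all words, since
  `w = head ++ reflect (reflected tail)`.

This is `hw_cut`, stub H1 of the line; its iteration (the generating-function product bound
`H(x) ≤ ∏ₐ (1 + Bₐ(x))`, Madras–Slade (3.1.4)) is stub H2, which takes this statement as its
hypothesis.

## References

* N. Madras, G. Slade, *The Self-Avoiding Walk*, Birkhäuser (1993), §3.1: proof of Theorem 3.1.1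
  and of Proposition 3.1.5 (the unfolding at the last maximum `n₁` of the first coordinate).
* J. M. Hammersley, D. J. A. Welsh, *Further results on the rate of convergence to the connective
  constant of the hypercubical lattice*, Quart. J. Math. Oxford (2) 13 (1962), 108–110.
-/

noncomputable section

open Literature.Probability.LatticeModels
open Literature.Probability.RandomPlanarGeometry Literature.Probability.RandomPlanarGeometry.SAW
open scoped ENNReal NNReal BigOperators
open Classical

namespace Summit.CriticalPhenomena.SAWScalingLimit.Theorems.CriticalBubbleBound.Kesten.HW

/-! ## Reflecting a word in the vertical axis -/

/-- If a letter map `r` negates `dx` and preserves `dy` (e.g. the swap `0 ↔ 2`), the endpoint of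
`w.map r` is the reflection of the endpoint of `w` in the axis `x₀ = 0`. [folklore] -/
theorem wEnd_map_of_dx (r : Step → Step) (hx : ∀ d, Step.dx (r d) = -Step.dx d)
    (hy : ∀ d, Step.dy (r d) = Step.dy d) (w : List Step) :
    wEnd (w.map r) = Zd.reflCoord 0 (wEnd w) := by
  induction w with
  | nil =>
    funext j
    fin_cases j <;> simp
  | cons d w ih =>
    rw [List.map_cons, wEnd_cons, wEnd_cons, ih]
    funext j
    fin_cases j
    · simp only [Fin.zero_eta, Fin.isValue, Pi.add_apply, Step.vec_apply_zero, hx,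
        Zd.reflCoord_apply_zero]
      ring
    · simp [hy]

/-- The trajectory of the reflected word is the pointwise reflection of the trajectory in the axis
`x₀ = 0`. [folklore] -/
theorem traj_map_of_dx (r : Step → Step) (hx : ∀ d, Step.dx (r d) = -Step.dx d)
    (hy : ∀ d, Step.dy (r d) = Step.dy d) (w : List Step) (i : ℕ) :
    traj (w.map r) i = Zd.reflCoord 0 (traj w i) := by
  rw [traj, traj, ← List.map_take, wEnd_map_of_dx r hx hy]

/-- The first coordinate of the reflected word is the opposite of the original one. [folklore] -/
theorem xAt_map_of_dx (r : Step → Step) (hx : ∀ d, Step.dx (r d) = -Step.dx d)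
    (hy : ∀ d, Step.dy (r d) = Step.dy d) (w : List Step) (i : ℕ) :
    xAt (w.map r) i = -xAt w i := by
  rw [xAt, xAt, traj_map_of_dx r hx hy w i, Zd.reflCoord_apply_zero]
  ring

/-- Reflection in the vertical axis preserves self-avoidance. [folklore] -/
theorem isSAW_map_of_dx (r : Step → Step) (hx : ∀ d, Step.dx (r d) = -Step.dx d)
    (hy : ∀ d, Step.dy (r d) = Step.dy d) {w : List Step} (hs : IsSAW w) : IsSAW (w.map r) := by
  rw [isSAW_iff_injOn] at hs ⊢
  have key : traj (w.map r) = Zd.reflCoord 0 ∘ traj w := funext fun i => traj_map_of_dx r hx hy w i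
  rw [List.length_map, key]
  exact (Zd.reflCoord_injective 0).comp_injOn hs

/-! ## First coordinates along a suffix -/

/-- First coordinate along a suffix: `x_{w.drop k}(i) = x_w(k + i) - x_w(k)` for `k ≤ |w|`
(translation invariance). [folklore] -/
theorem xAt_drop {w : List Step} {k : ℕ} (hk : k ≤ w.length) (i : ℕ) :
    xAt (w.drop k) i = xAt w (k + i) - xAt w k := by
  have hlen : (w.take k).length = k := by rw [List.length_take, min_eq_left hk]
  have h1 : xAt w (k + i) = xEnd (w.take k) + xAt (w.drop k) i := by
    have := xAt_append_right (w.take k) (w.drop k) i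
    rwa [List.take_append_drop, hlen] at this
  have h2 : xEnd (w.take k) = xAt w k := by
    rw [xEnd, hlen, xAt, xAt, traj_take w le_rfl]
  rw [h1, h2]
  ring

/-! ## The head: a bridge of maximal span -/

/-- **Head of the Hammersley–Welsh cut.** For a half-space word `w`, the prefix up to the last time
`n₁` at which the first coordinate is maximal is a bridge word whose span is the maximum `A₁`:
`0 < x(i)` by the half-space condition and `x(i) ≤ A₁ = x(n₁)` by maximality.
[cite: MadrasSlade1993, §3.1 (proof of Proposition 3.1.5)] -/
theorem take_lastArgmax_isBridgeW {w : List Step} (hh : Zd.IsHalfSpace w.length (traj w)) :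
    IsBridgeW (w.take (Zd.lastArgmax w.length (traj w))) ∧
      xEnd (w.take (Zd.lastArgmax w.length (traj w))) = Zd.maxLevel w.length (traj w) := by
  obtain ⟨hcn, hcA⟩ := Zd.lastArgmax_spec w.length (traj w)
  set c := Zd.lastArgmax w.length (traj w) with hc
  have hlen : (w.take c).length = c := by rw [List.length_take, min_eq_left hcn]
  have hxa : ∀ i ≤ c, xAt (w.take c) i = xAt w i := fun i hi => by
    rw [xAt, xAt, traj_take w hi]
  have hend : xEnd (w.take c) = Zd.maxLevel w.length (traj w) := by
    rw [xEnd, hlen, hxa c le_rfl]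
    exact hcA
  refine ⟨?_, hend⟩
  rw [isBridgeW_iff, hlen]
  intro i h1 hi
  rw [hxa i hi, hend]
  refine ⟨?_, Zd.apply_le_maxLevel (traj w) (hi.trans hcn)⟩
  have := hh i h1 (hi.trans hcn)
  simp only [traj_zero, Pi.zero_apply] at this
  exact this

/-! ## The tail, reflected: a half-space word of smaller maximum -/

/-- **Tail of the Hammersley–Welsh cut.** For a non-empty half-space word `w` with maximum `A₁`
of the first coordinate, last attained at time `n₁`, the suffix `w.drop n₁` reflected in the
vertical axis (letter map `r` negating `dx`, fixing `dy`) has first coordinates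
`A₁ - x(n₁ + i) > 0` for `i ≥ 1` (after `n₁` the walk is strictly below `A₁`) and `≤ A₁ - 1`
(as `x ≥ 1` on a half-space word and `n₁ ≥ 1`): it is a half-space word of maximum `≤ A₁ - 1`.
[cite: MadrasSlade1993, §3.1 (proof of Theorem 3.1.1, (3.1.2)–(3.1.3))] -/
theorem drop_lastArgmax_spec {w : List Step} (hh : Zd.IsHalfSpace w.length (traj w)) (hne : w ≠ [])
    (r : Step → Step) (hx : ∀ d, Step.dx (r d) = -Step.dx d) (hy : ∀ d, Step.dy (r d) = Step.dy d) :
    Zd.IsHalfSpace ((w.drop (Zd.lastArgmax w.length (traj w))).map r).length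
        (traj ((w.drop (Zd.lastArgmax w.length (traj w))).map r)) ∧
      Zd.maxLevel ((w.drop (Zd.lastArgmax w.length (traj w))).map r).length
          (traj ((w.drop (Zd.lastArgmax w.length (traj w))).map r)) + 1 ≤
        Zd.maxLevel w.length (traj w) := by
  obtain ⟨hcn, hcA⟩ := Zd.lastArgmax_spec w.length (traj w)
  set n := w.length with hn
  set c := Zd.lastArgmax n (traj w) with hc
  set A := Zd.maxLevel n (traj w) with hA
  have hcA' : xAt w c = A := hcA
  have hpos : ∀ i, 1 ≤ i → i ≤ n → 0 < xAt w i := fun i h1 h2 => by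
    have := hh i h1 h2
    simp only [traj_zero, Pi.zero_apply] at this
    exact this
  have hn1 : 1 ≤ n := by
    have := List.length_pos_iff.2 hne
    omega
  have hA1 : 1 ≤ A := by
    have h1 := hpos 1 le_rfl hn1
    have h2 : xAt w 1 ≤ A := Zd.apply_le_maxLevel (traj w) hn1
    omega
  have hc1 : 1 ≤ c := by
    by_contra h0
    have h0' : c = 0 := by omega
    rw [h0', xAt_zero] at hcA'
    omega
  have hlen : ((w.drop c).map r).length = n - c := by
    rw [List.length_map, List.length_drop]
  -- the first coordinates of the reflected tail
  have hxv : ∀ i, xAt ((w.drop c).map r) i = A - xAt w (c + i) := fun i => by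
    rw [xAt_map_of_dx r hx hy, xAt_drop hcn i, hcA']
    ring
  refine ⟨?_, ?_⟩
  · intro i h1 hi
    rw [hlen] at hi
    show xAt ((w.drop c).map r) 0 < xAt ((w.drop c).map r) i
    rw [hxv, hxv, add_zero, hcA']
    have hlt : xAt w (c + i) < A :=
      Zd.apply_lt_maxLevel_of_lastArgmax_lt (n := n) (traj w) (i := c + i) (by omega) (by omega)
    omega
  · have hle : Zd.maxLevel ((w.drop c).map r).length (traj ((w.drop c).map r)) ≤ A - 1 := by
      apply Zd.maxLevel_le
      intro i hi
      rw [hlen] at hi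
      show xAt ((w.drop c).map r) i ≤ A - 1
      rw [hxv]
      have := hpos (c + i) (by omega) (by omega)
      omega
    omega

/-! ## The cut -/

/-- **One-step Hammersley–Welsh cut of a half-space word** (stub H1 of the line). There is a map
`cut : w ↦ (head, tail')`, injective on all step words, such that for every non-empty
self-avoiding half-space word `w`: `head = w.take n₁` is a self-avoiding bridge word of span
`A₁(w)` (the maximum of the first coordinate, last attained at `n₁`), `tail'` (the suffix
`w.drop n₁` with the letters `0 ↔ 2` swapped, i.e. reflected in the vertical axis) is a
self-avoiding half-space word with `A₁(tail') + 1 ≤ A₁(w)`, and `|head| + |tail'| = |w|`.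
Injectivity: `w = head ++ swap (tail')`, the swap being an involution.
[cite: MadrasSlade1993, §3.1 (proof of Theorem 3.1.1, (3.1.2)–(3.1.4); proof of Proposition 3.1.5)] -/
theorem hw_cut : ∃ cut : List Step → List Step × List Step, Function.Injective cut ∧ ∀ w : List Step, IsSAW w → Zd.IsHalfSpace w.length (traj w) → w ≠ [] → IsSAW (cut w).1 ∧ IsBridgeW (cut w).1 ∧ xEnd (cut w).1 = Zd.maxLevel w.length (traj w) ∧ IsSAW (cut w).2 ∧ Zd.IsHalfSpace (cut w).2.length (traj (cut w).2) ∧ Zd.maxLevel (cut w).2.length (traj (cut w).2) + 1 ≤ Zd.maxLevel w.length (traj w) ∧ (cut w).1.length + (cut w).2.length = w.length := by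
  -- the letter swap `0 ↔ 2` (reflection in the vertical axis) and its properties
  have hx : ∀ d : Step,
      Step.dx ((fun d : Step => if d = 0 then (2 : Step) else if d = 2 then 0 else d) d) = -Step.dx d := by
    decide
  have hy : ∀ d : Step,
      Step.dy ((fun d : Step => if d = 0 then (2 : Step) else if d = 2 then 0 else d) d) = Step.dy d := by
    decide
  have hinv : ∀ d : Step, (fun d : Step => if d = 0 then (2 : Step) else if d = 2 then 0 else d)
      ((fun d : Step => if d = 0 then (2 : Step) else if d = 2 then 0 else d) d) = d := by
    decide
  have hinj : Function.Injective
      (List.map (fun d : Step => if d = 0 then (2 : Step) else if d = 2 then 0 else d)) :=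
    List.map_injective_iff.2 (Function.Involutive.injective hinv)
  refine ⟨fun w => (w.take (Zd.lastArgmax w.length (traj w)),
    (w.drop (Zd.lastArgmax w.length (traj w))).map
      (fun d : Step => if d = 0 then (2 : Step) else if d = 2 then 0 else d)), ?_, ?_⟩
  · -- injectivity: `w = head ++ swap tail'`
    intro w w' h
    dsimp only at h
    obtain ⟨h1, h2⟩ := Prod.mk.inj h
    have h3 := hinj h2
    rw [← List.take_append_drop (Zd.lastArgmax w.length (traj w)) w, h1, h3, List.take_append_drop]
  · intro w hs hh hne
    dsimp only
    obtain ⟨hb, hend⟩ := take_lastArgmax_isBridgeW hh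
    obtain ⟨hhalf, hmax⟩ := drop_lastArgmax_spec hh hne _ hx hy
    refine ⟨hs.take _, hb, hend, isSAW_map_of_dx _ hx hy (hs.drop _), hhalf, hmax, ?_⟩
    have hcn := (Zd.lastArgmax_spec w.length (traj w)).1
    rw [List.length_take, List.length_map, List.length_drop, min_eq_left hcn]
    omega

end Summit.CriticalPhenomena.SAWScalingLimit.Theorems.CriticalBubbleBound.Kesten.HW

end
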